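import Summits.QuantumFields.QCD.Theses.HeatSlicedQuarks

/-!
# Lead c4 (2026-08-16T18:5xZ): the COMMON stuck goal of every heavy-threshold line on crux
stmt-QuantumFields-8892 after the statement re-type p117723 — recorded verbatim by elaboration.

Every line's composition ends (or ended) with: from threshold data
`∃ M₀ ≥ 0, ∃ reg, HasMassScaling ∧ ∀ m > M₀, (honest data ∧ both gap clauses)` conclude `QCDOf Nf`.
The only regularisation such data name for the conjunct is the `m_crit`-shifted one (`shiftReg reg M₀`),
and the re-typed `QCDOf` then leaves exactly ONE goal open: `(shiftReg reg M₀).IsChiralAtZero`.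
The `example` below closes everything else and leaves that goal as its single `sorry` (goal text recorded verbatim).
-/

namespace Summit.QuantumFields.QCD.Cruxes.RobustYangMillsHandover.StuckC4

open Literature.MathematicalPhysics.QuantumFieldTheory

variable {Nf : ℕ}

/-- The pre-re-type threshold form (= what every heavy-threshold line delivers). -/
def QCDOfAboveThreshold (Nf : ℕ) : Prop :=
  ∃ M₀ : ℝ, 0 ≤ M₀ ∧ ∃ reg : QCDRegularisation Nf,
    reg.HasMassScaling ∧ ∀ m : Fin Nf → ℝ, (∀ f, M₀ < m f) →
      ∃ (z shift : QCDField Nf → ℕ → ℝ) (T : OSData (QCDField Nf) 4),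
        IsQCDAlong (reg.scheme m z shift) T ∧ T.IsNontrivial QCDField.glue ∧ T.IsNonGaussian QCDField.glue ∧
          (∀ f g : Fin Nf, f ≠ g → T.IsNontrivial (QCDField.pseudoRe f g)) ∧
            ∃ Δ > 0, T.HasMassGap Δ ∧ (reg.scheme m z shift).HasLatticeMassGap Δ

/-- The threshold-shifted regularisation. -/
noncomputable def shiftReg (reg : QCDRegularisation Nf) (M₀ : ℝ) : QCDRegularisation Nf :=
  { reg with mcrit := fun k => reg.mcrit k + reg.a k * M₀ / reg.Zm k }

theorem shiftReg_scheme (reg : QCDRegularisation Nf) (M₀ : ℝ) (m : Fin Nf → ℝ)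
    (z shift : QCDField Nf → ℕ → ℝ) :
    (shiftReg reg M₀).scheme m z shift = reg.scheme (fun f => M₀ + m f) z shift := by
  simp only [shiftReg, QCDRegularisation.scheme, QCDScheme.mk.injEq, true_and, and_true]
  funext f k
  ring

/-- The former head step `qcdOf_iff_threshold.mpr`, replayed against the RE-TYPED `QCDOf`:
everything closes except chirality of the shifted regularisation (left open on purpose). -/
example (h : QCDOfAboveThreshold Nf) : QCDOf Nf := by
  obtain ⟨M₀, -, reg, hMS, h⟩ := h
  refine ⟨shiftReg reg M₀, hMS, ?chiral, fun m hm => ?data⟩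
  case data =>
    obtain ⟨z, shift, T, hQ, hN, hG, hP, Δ, hΔ, hT, hL⟩ :=
      h (fun f => M₀ + m f) (fun f => by linarith [hm f])
    refine ⟨z, shift, T, ?_, hN, hG, hP, Δ, hΔ, hT, ?_⟩
    · rwa [shiftReg_scheme]
    · rwa [shiftReg_scheme]
  case chiral =>
    unfold QCDRegularisation.IsChiralAtZero
    simp only [shiftReg_scheme]
    /- STUCK. Verbatim goal printed by `lean check` (rc 1 with `done` in place of this `sorry`, 18:4xZ):
         Nf : ℕ
         M₀ : ℝ
         reg : QCDRegularisation Nf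
         hMS : reg.HasMassScaling
         h : ∀ (m : Fin Nf → ℝ), (∀ (f : Fin Nf), M₀ < m f) →
               ∃ z shift T, IsQCDAlong (reg.scheme m z shift) T ∧ T.IsNontrivial QCDField.glue ∧
                 T.IsNonGaussian QCDField.glue ∧ (∀ (f g : Fin Nf), f ≠ g → T.IsNontrivial (QCDField.pseudoRe f g)) ∧
                   ∃ Δ > 0, T.HasMassGap Δ ∧ (reg.scheme m z shift).HasLatticeMassGap Δ
         ⊢ ∀ ε > 0, ∃ m, (∀ (f : Fin Nf), 0 < m f) ∧ ¬(reg.scheme (fun f => M₀ + m f) 0 0).HasLatticeMassGap ε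
       i.e. gapless-at-every-rate points of X₀'s OWN regularisation just above the threshold `M₀` — light-quark
       content no heavy-threshold mechanism supplies (and FALSE whenever the gap above `M₀` is uniform:
       `RetypeDichotomyC3.not_isChiralAtZero_shift_of_uniformGapAbove`). -/
    sorry

end Summit.QuantumFields.QCD.Cruxes.RobustYangMillsHandover.StuckC4
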